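import Mathlib
import Literature.NumberTheory.Automorphic.ClosedCompactDecomposition
import HarnessLib

/-!
# F0 · P3c · line LH6 «StCharTS» — «HAAR-FAMILY★»: simultaneous Haar measures on the closed subgroups of a locally compact group,
# PROBABILITY (and unimodular) on the compact ones — the instantiation of the RUNG0 PARAMETERS `μTf` ∕ `μTHf`

Cell `pub/hodgecm-mathlib`, FLOOR 0, crux H413 = stmt-HodgeConjecture-24833, SUPPORTS-ONLY lane
(`--kind proof --supports stmt-HodgeConjecture-24833 --as helper`), prover seat F0P2-p01 (g22), 2026-09-02.  THEOREMS ONLY,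
generic (any topological group `G`; no `U(3)`), Mathlib + ONE ★ Literature import (`ClosedCompactDecomposition`: compact groups are
unimodular) + HarnessLib.  Touches no registry and no served Line; count-neutral.

WHY.  The rung-0 assembler of the LH6 organ (S-𝔇) (`F0P3cStCharTSRung0 :: ellipticPackage_of_namedBlock`, rf f79bbe03, LH6-p01 (g4))
takes the CARTAN DATA as PARAMETERS `(Sell : Finset (Subgroup G_v)) (μTf : (T : Subgroup G_v) → Measure ↥T)` and
`(SH : Finset (Subgroup H_v)) (μTHf : (T : Subgroup H_v) → Measure ↥T)` with the OUTER HYPOTHESES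
`hHaarGO : ∀ T ∈ Sell, (μTf T).IsHaarMeasure`, `hfinGO : ∀ T ∈ Sell, IsFiniteMeasure (μTf T)`, `hHaarMO : (μTf M).IsHaarMeasure`
(`M` the split torus, a CLOSED non-compact subgroup), `hFHO : ∀ T ∈ SH, IsFiniteMeasure (μTHf T)`; and the (P5) «CARTAN-ELL-H» ∃-fact
(★ `F0P3cStCharTSHFields.cartanH_pins_of_cartanEllH`, clause 1) wants `(μTHf T).IsHaarMeasure ∧ IsProbabilityMeasure (μTHf T)` on every
compact representative — print's normalisation «meas(T) = 1» for the elliptic tori in the Weyl integration formula [Rogawski1990, §12.5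
p. 184; §3.6].  Whoever instantiates the rung-0 theorem must therefore produce ONE family of measures indexed by ALL subgroups that is Haar on
the closed ones and a Haar PROBABILITY on the compact ones.  This file is that producer, once and for all:

* §1 `exists_isHaarMeasure_isProbabilityMeasure_of_isCompact_subgroup` — a compact subgroup `T ≤ G` (any Hausdorff topological group)
  carries a Haar probability measure on `↥T` (Mathlib `haarMeasure ⊤`, normalised on the positive compact `univ`);
  `exists_isHaarMeasure_of_isClosed_subgroup` — a closed subgroup of a locally compact group carries a Haar measure (Mathlib `haar` on the
  closed, hence locally compact, subtype); `…_unimodular_…` — on a compact subgroup of a second-countable group the Haar probability is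
  also right- and inversion-invariant (★ `isMulRightInvariant_of_compactSpace` ∕ ★ `isInvInvariant_of_compactSpace`).
* §2 THE FAMILY `exists_haarFamily` — `∃ μTf : (T : Subgroup G) → Measure ↥T, (∀ T closed, Haar) ∧ (∀ T compact, Haar ∧ probability)`
  (and the unimodular refinement `exists_haarFamily_unimodular`).
* §3 RUNG0 SHAPES, token for token: `exists_haarFamily_rung0` = `∃ μTf, hHaarGO ∧ hfinGO ∧ (∀ T ∈ Sell, IsProbabilityMeasure (μTf T)) ∧ hHaarMO`
  from `hcartO`'s compactness conjunct and `IsClosed M`; `exists_haarFamily_rung0H` = `∃ μTHf, (∀ T ∈ SH, Haar ∧ probability) ∧ hFHO` from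
  `hKHO` alone (no local compactness needed on the `H` side).

HONEST LABEL: HC_CM is proved only modulo the 7 printed citations (2 remaining named inputs: hLiu418 = stmt-HodgeConjecture-24832,
h413 = stmt-HodgeConjecture-24833) until rung 0 closes; this file is pure measure theory and pays nothing by itself.

## References
* [Rogawski1990] J. D. Rogawski, *Automorphic Representations of Unitary Groups in Three Variables*, Ann. of Math. Stud. 123 (1990):
  §1.7 p. 6 («all measures on groups are Haar measures»), §3.6 pp. 28–31 (Cartan subgroups), §12.5 p. 184 (normalised torus measures in
  the Weyl integration formula for `U(3)`).
* [Folland1995] G. B. Folland, *A Course in Abstract Harmonic Analysis* (1995), §2.2 (existence of Haar measure), Thm. 2.49.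
-/

set_option autoImplicit false
-- the mandated namespace repeats `HodgeConjecture.HodgeConjecture`, as in every `Theorems/*.lean` of this sub-problem
set_option linter.dupNamespace false

noncomputable section

namespace Summit.HodgeConjecture.HodgeConjecture.Cruxes.H413.F0P3cStCharTSHaarFamily

open MeasureTheory MeasureTheory.Measure TopologicalSpace Set

variable {G : Type*} [Group G] [TopologicalSpace G] [IsTopologicalGroup G] [MeasurableSpace G] [BorelSpace G]

/-! ## §1 One subgroup at a time -/

/-- **A compact subgroup carries a Haar PROBABILITY measure** (on the subtype `↥T`): Mathlib's `haarMeasure` normalised on the positive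
compact `⊤ = univ` of the compact group `↥T`.  No local compactness or Hausdorff hypothesis on `G` is needed. [folklore]
[cite: Folland1995, §2.2] -/
theorem exists_isHaarMeasure_isProbabilityMeasure_of_isCompact_subgroup (T : Subgroup G) (hT : IsCompact (T : Set G)) :
    ∃ μ : Measure ↥T, μ.IsHaarMeasure ∧ IsProbabilityMeasure μ := by
  haveI : CompactSpace ↥T := isCompact_iff_compactSpace.mp hT
  refine ⟨haarMeasure (⊤ : PositiveCompacts ↥T), inferInstance, ⟨?_⟩⟩
  rw [← PositiveCompacts.coe_top]
  exact haarMeasure_self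

/-- **A closed subgroup of a locally compact group carries a Haar measure** (on the subtype `↥T`): the subtype of a closed set is locally
compact, so Mathlib's `haar` applies. [folklore] [cite: Folland1995, §2.2] -/
theorem exists_isHaarMeasure_of_isClosed_subgroup [LocallyCompactSpace G] (T : Subgroup G) (hT : IsClosed (T : Set G)) :
    ∃ μ : Measure ↥T, μ.IsHaarMeasure := by
  haveI : LocallyCompactSpace ↥T := hT.isClosedEmbedding_subtypeVal.locallyCompactSpace
  exact ⟨haar, inferInstance⟩

/-- **On a compact subgroup of a Hausdorff second-countable group the Haar probability measure is also right- and inversion-invariant**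
(compact groups are unimodular: ★ `Literature.NumberTheory.Automorphic.isMulRightInvariant_of_compactSpace` ∕ `…isInvInvariant_of_compactSpace`).
[folklore] [cite: Folland1995, Thm. 2.49] -/
theorem exists_isHaarMeasure_isProbabilityMeasure_unimodular_of_isCompact_subgroup [T2Space G] [SecondCountableTopology G]
    (T : Subgroup G) (hT : IsCompact (T : Set G)) :
    ∃ μ : Measure ↥T, μ.IsHaarMeasure ∧ IsProbabilityMeasure μ ∧ μ.IsMulRightInvariant ∧ μ.IsInvInvariant := by
  haveI : CompactSpace ↥T := isCompact_iff_compactSpace.mp hT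
  haveI : SecondCountableTopology ↥T := TopologicalSpace.Subtype.secondCountableTopology _
  obtain ⟨μ, hμ, hprob⟩ := exists_isHaarMeasure_isProbabilityMeasure_of_isCompact_subgroup T hT
  exact ⟨μ, hμ, hprob, Literature.NumberTheory.Automorphic.isMulRightInvariant_of_compactSpace μ,
    Literature.NumberTheory.Automorphic.isInvInvariant_of_compactSpace μ⟩

/-! ## §2 The simultaneous family indexed by ALL subgroups -/

/-- **HAAR-FAMILY.**  On a locally compact group there is ONE family `μTf : (T : Subgroup G) → Measure ↥T` that is a Haar measure on every
CLOSED subgroup and a Haar PROBABILITY measure on every COMPACT subgroup (junk value `0` on the non-closed ones).  This is the object the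
rung-0 assembler's parameters `μTf`∕`μTHf` are instantiated with. [folklore] [cite: Rogawski1990, §1.7 p. 6; §12.5 p. 184] -/
theorem exists_haarFamily [LocallyCompactSpace G] :
    ∃ μTf : (T : Subgroup G) → Measure ↥T,
      (∀ T : Subgroup G, IsClosed (T : Set G) → (μTf T).IsHaarMeasure) ∧
      (∀ T : Subgroup G, IsCompact (T : Set G) → (μTf T).IsHaarMeasure ∧ IsProbabilityMeasure (μTf T)) := by
  classical
  refine ⟨fun T => if hc : IsCompact (T : Set G) then (exists_isHaarMeasure_isProbabilityMeasure_of_isCompact_subgroup T hc).choose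
      else if hcl : IsClosed (T : Set G) then (exists_isHaarMeasure_of_isClosed_subgroup T hcl).choose else 0, ?_, ?_⟩
  · intro T hcl
    by_cases hc : IsCompact (T : Set G)
    · simp only [dif_pos hc]
      exact (exists_isHaarMeasure_isProbabilityMeasure_of_isCompact_subgroup T hc).choose_spec.1
    · simp only [dif_neg hc, dif_pos hcl]
      exact (exists_isHaarMeasure_of_isClosed_subgroup T hcl).choose_spec
  · intro T hc
    simp only [dif_pos hc]
    exact (exists_isHaarMeasure_isProbabilityMeasure_of_isCompact_subgroup T hc).choose_spec

/-- **HAAR-FAMILY, compact subgroups only** — no local compactness of `G` needed: a family that is a Haar probability measure on every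
compact subgroup (junk `0` elsewhere). [folklore] [cite: Rogawski1990, §12.5 p. 184] -/
theorem exists_haarFamily_of_isCompact :
    ∃ μTf : (T : Subgroup G) → Measure ↥T,
      ∀ T : Subgroup G, IsCompact (T : Set G) → (μTf T).IsHaarMeasure ∧ IsProbabilityMeasure (μTf T) := by
  classical
  refine ⟨fun T => if hc : IsCompact (T : Set G) then (exists_isHaarMeasure_isProbabilityMeasure_of_isCompact_subgroup T hc).choose
      else 0, fun T hc => ?_⟩
  simp only [dif_pos hc]
  exact (exists_isHaarMeasure_isProbabilityMeasure_of_isCompact_subgroup T hc).choose_spec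

/-- **HAAR-FAMILY, unimodular refinement** (Hausdorff, second countable, locally compact `G`): Haar on the closed subgroups, and on the
compact ones a Haar probability measure that is right- and inversion-invariant. [folklore] [cite: Folland1995, §2.2, Thm. 2.49] -/
theorem exists_haarFamily_unimodular [T2Space G] [SecondCountableTopology G] [LocallyCompactSpace G] :
    ∃ μTf : (T : Subgroup G) → Measure ↥T,
      (∀ T : Subgroup G, IsClosed (T : Set G) → (μTf T).IsHaarMeasure) ∧
      (∀ T : Subgroup G, IsCompact (T : Set G) →
        (μTf T).IsHaarMeasure ∧ IsProbabilityMeasure (μTf T) ∧ (μTf T).IsMulRightInvariant ∧ (μTf T).IsInvInvariant) := by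
  classical
  refine ⟨fun T => if hc : IsCompact (T : Set G) then
        (exists_isHaarMeasure_isProbabilityMeasure_unimodular_of_isCompact_subgroup T hc).choose
      else if hcl : IsClosed (T : Set G) then (exists_isHaarMeasure_of_isClosed_subgroup T hcl).choose else 0, ?_, ?_⟩
  · intro T hcl
    by_cases hc : IsCompact (T : Set G)
    · simp only [dif_pos hc]
      exact (exists_isHaarMeasure_isProbabilityMeasure_unimodular_of_isCompact_subgroup T hc).choose_spec.1
    · simp only [dif_neg hc, dif_pos hcl]
      exact (exists_isHaarMeasure_of_isClosed_subgroup T hcl).choose_spec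
  · intro T hc
    simp only [dif_pos hc]
    exact (exists_isHaarMeasure_isProbabilityMeasure_unimodular_of_isCompact_subgroup T hc).choose_spec

/-! ## §3 The rung-0 shapes (outer hypotheses `hHaarGO` `hfinGO` `hHaarMO` ∕ `hFHO` of `ellipticPackage_of_namedBlock`, token for token) -/

/-- **RUNG0 shape, `G` side.**  For every finite set `Sell` of subgroups whose members are compact (the compactness conjunct of the
outer hypothesis `hcartO`) and every CLOSED subgroup `M` (the split torus) of a locally compact group there is ONE family `μTf` with
`hHaarGO : ∀ T ∈ Sell, (μTf T).IsHaarMeasure`, `hfinGO : ∀ T ∈ Sell, IsFiniteMeasure (μTf T)`, the print normalisation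
`∀ T ∈ Sell, IsProbabilityMeasure (μTf T)`, and `hHaarMO : (μTf M).IsHaarMeasure`. [folklore] [cite: Rogawski1990, §12.5 p. 184] -/
theorem exists_haarFamily_rung0 [LocallyCompactSpace G] {P : Subgroup G → Prop} (Sell : Finset (Subgroup G))
    (hcartO : ∀ T ∈ Sell, IsCompact (T : Set G) ∧ P T) (M : Subgroup G) (hM : IsClosed (M : Set G)) :
    ∃ μTf : (T : Subgroup G) → Measure ↥T,
      (∀ T ∈ Sell, (μTf T).IsHaarMeasure) ∧ (∀ T ∈ Sell, IsFiniteMeasure (μTf T)) ∧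
      (∀ T ∈ Sell, IsProbabilityMeasure (μTf T)) ∧ (μTf M).IsHaarMeasure := by
  obtain ⟨μTf, hcl, hc⟩ := exists_haarFamily (G := G)
  refine ⟨μTf, fun T hT => (hc T (hcartO T hT).1).1, fun T hT => ?_, fun T hT => (hc T (hcartO T hT).1).2, hcl M hM⟩
  haveI := (hc T (hcartO T hT).1).2
  infer_instance

/-- **RUNG0 shape, `H` side.**  For every finite set `SH` of subgroups whose members are compact (outer hypothesis `hKHO`) of ANY
topological group there is ONE family `μTHf` that is a Haar PROBABILITY measure on each member — in particular
`hFHO : ∀ T ∈ SH, IsFiniteMeasure (μTHf T)` and the measure conjunct of clause 1 of «CARTAN-ELL-H» (★ `cartanH_pins_of_cartanEllH`).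
[folklore] [cite: Rogawski1990, §12.5 p. 184; §3.6] -/
theorem exists_haarFamily_rung0H (SH : Finset (Subgroup G)) (hKHO : ∀ T ∈ SH, IsCompact (T : Set G)) :
    ∃ μTHf : (T : Subgroup G) → Measure ↥T,
      (∀ T ∈ SH, (μTHf T).IsHaarMeasure ∧ IsProbabilityMeasure (μTHf T)) ∧ (∀ T ∈ SH, IsFiniteMeasure (μTHf T)) := by
  obtain ⟨μTHf, hc⟩ := exists_haarFamily_of_isCompact (G := G)
  refine ⟨μTHf, fun T hT => hc T (hKHO T hT), fun T hT => ?_⟩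
  haveI := (hc T (hKHO T hT)).2
  infer_instance

end Summit.HodgeConjecture.HodgeConjecture.Cruxes.H413.F0P3cStCharTSHaarFamily

end
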